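import Mathlib
import HarnessLib

/-!
# Route `KLProgramme` (cruxes K3/K1, risk r2) — FST II Theorem 1.1 (two-loop volume) for the Hubbard band, part 5:
# two abstract dyadic (layer-cake) lemmas for the outer integration

Cell `gate-hubbard-kl`, seat fs-1 (g5), risk-register item r2. Pure measure theory on `ℝ`, no band geometry: the two
bookkeeping lemmas that turn «inner angular measure `≤ Kε/s` at torus distance `∈ [s/2, s)` from the Cooper point, outer
measure of that region `≤ K₁ s`» into `O(ε)` per dyadic scale (`kltl_dyadic_cooper`), and «inner measure `≤ aε + bε/√s`
outside the `s`-neighbourhood of the caustic, outer measure of the `s`-neighbourhood `≤ D√s`» into `O(ε)` per dyadic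
scale (`kltl_dyadic_caustic`) — the logarithm of FST II Theorem 1.1 is the number of scales. Both are proved by
peeling one dyadic layer at a time (`lintegral_union_le`, `setLIntegral_mono`, `setLIntegral_const`); no measurability
hypotheses are needed. No definitions; everything PROVED. [folklore]
-/

noncomputable section

open Real Set MeasureTheory
open scoped ENNReal

-- the tree's namespace `Summit.<Summit>.<Problem>.Theorems` repeats the summit name by design (D-0017)
set_option linter.dupNamespace false

namespace Summit.HubbardSuperconductivity.HubbardSuperconductivity.Theorems

/-- Splitting a restricted lower integral along a set and its complement (inequality form, no measurability). [folklore] -/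
theorem kltl_lintegral_split_le (I S : Set ℝ) (f : ℝ → ℝ≥0∞) :
    ∫⁻ θ in I, f θ ≤ (∫⁻ θ in I ∩ S, f θ) + ∫⁻ θ in I \ S, f θ := by
  have hsub : I ⊆ (I ∩ S) ∪ (I \ S) := by
    intro x hx; by_cases h : x ∈ S
    · exact Or.inl ⟨hx, h⟩
    · exact Or.inr ⟨hx, h⟩
  exact (lintegral_mono' (Measure.restrict_mono hsub le_rfl) le_rfl).trans (lintegral_union_le _ _ _)

/-- A restricted lower integral of a function bounded by a constant on the set. [folklore] -/
theorem kltl_setLIntegral_le_const_mul {S : Set ℝ} {f : ℝ → ℝ≥0∞} {c : ℝ≥0∞} (h : ∀ θ ∈ S, f θ ≤ c) :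
    ∫⁻ θ in S, f θ ≤ c * volume S :=
  (setLIntegral_mono measurable_const h).trans (by rw [setLIntegral_const])

/-- **Dyadic lemma, Cooper side.** Let `C s` (`0 < s ≤ v`) be sets with `vol(I ∩ C s) ≤ K₁ s`, let `f ≤ A`
everywhere and `f ≤ K₂ ε/s` on `C s ∖ C (s/2)`. Then for every `J`,
`∫_{I ∩ C v} f ≤ J·K₁K₂ε + A K₁ v/2^J`. [folklore] -/
theorem kltl_dyadic_cooper {I : Set ℝ} {C : ℝ → Set ℝ} {f : ℝ → ℝ≥0∞} {v K₁ K₂ ε A : ℝ}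
    (hv : 0 < v) (hK₁ : 0 ≤ K₁) (hK₂ : 0 ≤ K₂) (hε : 0 ≤ ε) (hA : 0 ≤ A)
    (hvol : ∀ s, 0 < s → s ≤ v → volume (I ∩ C s) ≤ ENNReal.ofReal (K₁ * s))
    (hf : ∀ s, 0 < s → s ≤ v → ∀ θ ∈ C s, θ ∉ C (s / 2) → f θ ≤ ENNReal.ofReal (K₂ * ε / s))
    (hfA : ∀ θ, f θ ≤ ENNReal.ofReal A) (J : ℕ) :
    ∫⁻ θ in I ∩ C v, f θ ≤ ENNReal.ofReal (J * (K₁ * K₂ * ε) + A * K₁ * (v / 2 ^ J)) := by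
  -- peel one layer at a time: `S₀ ≤ n K₁K₂ε + S_n`, `S_n = ∫_{I ∩ C(v/2^n)} f`
  have peel : ∀ n : ℕ, ∫⁻ θ in I ∩ C v, f θ ≤
      ENNReal.ofReal (n * (K₁ * K₂ * ε)) + ∫⁻ θ in I ∩ C (v / 2 ^ n), f θ := by
    intro n
    induction n with
    | zero => simp
    | succ n ih =>
      have hs : 0 < v / 2 ^ n := by positivity
      have hsv : v / 2 ^ n ≤ v := div_le_self hv.le (one_le_pow₀ (by norm_num))
      have hhalf : v / 2 ^ n / 2 = v / 2 ^ (n + 1) := by rw [pow_succ]; ring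
      -- the layer `C(v/2^n) \ C(v/2^(n+1))`
      have hlayer : ∫⁻ θ in (I ∩ C (v / 2 ^ n)) \ C (v / 2 ^ (n + 1)), f θ ≤ ENNReal.ofReal (K₁ * K₂ * ε) := by
        refine (kltl_setLIntegral_le_const_mul (c := ENNReal.ofReal (K₂ * ε / (v / 2 ^ n))) ?_).trans ?_
        · rintro θ ⟨⟨-, hθC⟩, hθn⟩
          exact hf _ hs hsv θ hθC (by rwa [hhalf])
        · calc ENNReal.ofReal (K₂ * ε / (v / 2 ^ n)) * volume ((I ∩ C (v / 2 ^ n)) \ C (v / 2 ^ (n + 1)))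
              ≤ ENNReal.ofReal (K₂ * ε / (v / 2 ^ n)) * ENNReal.ofReal (K₁ * (v / 2 ^ n)) := by
                gcongr; exact (measure_mono fun x hx => hx.1).trans (hvol _ hs hsv)
            _ = ENNReal.ofReal (K₁ * K₂ * ε) := by
                rw [← ENNReal.ofReal_mul (by positivity)]
                congr 1; field_simp
      have hsplit := kltl_lintegral_split_le (I ∩ C (v / 2 ^ n)) (C (v / 2 ^ (n + 1))) f
      have hinter : (I ∩ C (v / 2 ^ n)) ∩ C (v / 2 ^ (n + 1)) ⊆ I ∩ C (v / 2 ^ (n + 1)) :=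
        fun θ hθ => ⟨hθ.1.1, hθ.2⟩
      have hmono : ∫⁻ θ in (I ∩ C (v / 2 ^ n)) ∩ C (v / 2 ^ (n + 1)), f θ ≤ ∫⁻ θ in I ∩ C (v / 2 ^ (n + 1)), f θ :=
        lintegral_mono' (Measure.restrict_mono hinter le_rfl) le_rfl
      calc ∫⁻ θ in I ∩ C v, f θ ≤ ENNReal.ofReal (n * (K₁ * K₂ * ε)) + ∫⁻ θ in I ∩ C (v / 2 ^ n), f θ := ih
        _ ≤ ENNReal.ofReal (n * (K₁ * K₂ * ε)) +
              (ENNReal.ofReal (K₁ * K₂ * ε) + ∫⁻ θ in I ∩ C (v / 2 ^ (n + 1)), f θ) := by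
            gcongr
            exact hsplit.trans (by rw [add_comm]; exact add_le_add hlayer hmono)
        _ = ENNReal.ofReal (((n + 1 : ℕ) : ℝ) * (K₁ * K₂ * ε)) + ∫⁻ θ in I ∩ C (v / 2 ^ (n + 1)), f θ := by
            rw [← add_assoc, ← ENNReal.ofReal_add (by positivity) (by positivity)]
            congr 2; push_cast; ring
  -- the innermost layer
  have hJ : 0 < v / 2 ^ J := by positivity
  have hJv : v / 2 ^ J ≤ v := div_le_self hv.le (one_le_pow₀ (by norm_num))
  have htail : ∫⁻ θ in I ∩ C (v / 2 ^ J), f θ ≤ ENNReal.ofReal (A * K₁ * (v / 2 ^ J)) := by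
    refine (kltl_setLIntegral_le_const_mul (c := ENNReal.ofReal A) fun θ _ => hfA θ).trans ?_
    calc ENNReal.ofReal A * volume (I ∩ C (v / 2 ^ J)) ≤ ENNReal.ofReal A * ENNReal.ofReal (K₁ * (v / 2 ^ J)) := by
          gcongr; exact hvol _ hJ hJv
      _ = ENNReal.ofReal (A * K₁ * (v / 2 ^ J)) := by rw [← ENNReal.ofReal_mul hA]; congr 1; ring
  calc ∫⁻ θ in I ∩ C v, f θ ≤ ENNReal.ofReal (J * (K₁ * K₂ * ε)) + ∫⁻ θ in I ∩ C (v / 2 ^ J), f θ := peel J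
    _ ≤ ENNReal.ofReal (J * (K₁ * K₂ * ε)) + ENNReal.ofReal (A * K₁ * (v / 2 ^ J)) := by gcongr
    _ = ENNReal.ofReal (J * (K₁ * K₂ * ε) + A * K₁ * (v / 2 ^ J)) :=
        (ENNReal.ofReal_add (by positivity) (by positivity)).symm

/-- **Dyadic lemma, caustic side.** Let `K s` be sets with `vol(A ∩ K s) ≤ D√s` (`s > 0`), `vol A ≤ L`, let
`f ≤ M` on `A` and `f ≤ aε + bε/√s` on `A ∖ K s` whenever `s₁ ≤ s`. Then for every `n` with `s₁ ≤ r₀/2^n`,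
`∫_A f ≤ (aε + bε/√r₀) L + n·(aD√r₀ + bD√2) ε + M D √(r₀/2^n)`. [folklore] -/
theorem kltl_dyadic_caustic {A : Set ℝ} {K : ℝ → Set ℝ} {f : ℝ → ℝ≥0∞} {r₀ s₁ D a b ε M L : ℝ}
    (hr₀ : 0 < r₀) (hD : 0 ≤ D) (ha : 0 ≤ a) (hb : 0 ≤ b) (hε : 0 ≤ ε) (hM : 0 ≤ M) (hL : 0 ≤ L)
    (hvolA : volume A ≤ ENNReal.ofReal L)
    (hvol : ∀ s, 0 < s → volume (A ∩ K s) ≤ ENNReal.ofReal (D * Real.sqrt s))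
    (hf : ∀ s, s₁ ≤ s → ∀ θ ∈ A, θ ∉ K s → f θ ≤ ENNReal.ofReal (a * ε + b * ε / Real.sqrt s))
    (hfM : ∀ θ ∈ A, f θ ≤ ENNReal.ofReal M) {n : ℕ} (hn : s₁ ≤ r₀ / 2 ^ n) :
    ∫⁻ θ in A, f θ ≤ ENNReal.ofReal ((a * ε + b * ε / Real.sqrt r₀) * L + n * ((a * D * Real.sqrt r₀ + b * D * Real.sqrt 2) * ε) +
      M * D * Real.sqrt (r₀ / 2 ^ n)) := by
  have hs₁r₀ : s₁ ≤ r₀ := hn.trans (div_le_self hr₀.le (one_le_pow₀ (by norm_num)))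
  -- the part outside `K r₀`
  have hout : ∫⁻ θ in A \ K r₀, f θ ≤ ENNReal.ofReal ((a * ε + b * ε / Real.sqrt r₀) * L) := by
    refine (kltl_setLIntegral_le_const_mul (c := ENNReal.ofReal (a * ε + b * ε / Real.sqrt r₀)) ?_).trans ?_
    · rintro θ ⟨hθA, hθK⟩; exact hf r₀ hs₁r₀ θ hθA hθK
    · calc ENNReal.ofReal (a * ε + b * ε / Real.sqrt r₀) * volume (A \ K r₀)
          ≤ ENNReal.ofReal (a * ε + b * ε / Real.sqrt r₀) * ENNReal.ofReal L := by
            gcongr; exact (measure_mono fun x hx => hx.1).trans hvolA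
        _ = ENNReal.ofReal ((a * ε + b * ε / Real.sqrt r₀) * L) := (ENNReal.ofReal_mul (by positivity)).symm
  -- peeling: `∫_{A ∩ K r₀} f ≤ k (aD√r₀ + bD√2) ε + ∫_{A ∩ K(r₀/2^k)} f` for `k ≤ n`
  have peel : ∀ k : ℕ, k ≤ n → ∫⁻ θ in A ∩ K r₀, f θ ≤
      ENNReal.ofReal (k * ((a * D * Real.sqrt r₀ + b * D * Real.sqrt 2) * ε)) + ∫⁻ θ in A ∩ K (r₀ / 2 ^ k), f θ := by
    intro k hk
    induction k with
    | zero => simp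
    | succ k ih =>
      have ih := ih (Nat.le_of_succ_le hk)
      have hsk : 0 < r₀ / 2 ^ k := by positivity
      have hsk1 : 0 < r₀ / 2 ^ (k + 1) := by positivity
      have hs₁k : s₁ ≤ r₀ / 2 ^ (k + 1) :=
        hn.trans (div_le_div_of_nonneg_left hr₀.le (by positivity) (pow_le_pow_right₀ (by norm_num) hk))
      have hsqrt_ratio : Real.sqrt (r₀ / 2 ^ k) / Real.sqrt (r₀ / 2 ^ (k + 1)) = Real.sqrt 2 := by
        rw [← Real.sqrt_div' _ hsk1.le]
        congr 1
        rw [pow_succ]; field_simp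
      have hsqrt_le : Real.sqrt (r₀ / 2 ^ k) ≤ Real.sqrt r₀ :=
        Real.sqrt_le_sqrt (div_le_self hr₀.le (one_le_pow₀ (by norm_num)))
      have hlayer : ∫⁻ θ in (A ∩ K (r₀ / 2 ^ k)) \ K (r₀ / 2 ^ (k + 1)), f θ ≤
          ENNReal.ofReal ((a * D * Real.sqrt r₀ + b * D * Real.sqrt 2) * ε) := by
        refine (kltl_setLIntegral_le_const_mul
          (c := ENNReal.ofReal (a * ε + b * ε / Real.sqrt (r₀ / 2 ^ (k + 1)))) ?_).trans ?_
        · rintro θ ⟨⟨hθA, -⟩, hθn⟩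
          exact hf _ hs₁k θ hθA hθn
        · calc ENNReal.ofReal (a * ε + b * ε / Real.sqrt (r₀ / 2 ^ (k + 1))) *
                volume ((A ∩ K (r₀ / 2 ^ k)) \ K (r₀ / 2 ^ (k + 1)))
              ≤ ENNReal.ofReal (a * ε + b * ε / Real.sqrt (r₀ / 2 ^ (k + 1))) *
                  ENNReal.ofReal (D * Real.sqrt (r₀ / 2 ^ k)) := by
                gcongr; exact (measure_mono fun x hx => hx.1).trans (hvol _ hsk)
            _ = ENNReal.ofReal (a * ε * D * Real.sqrt (r₀ / 2 ^ k) +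
                  b * ε * D * (Real.sqrt (r₀ / 2 ^ k) / Real.sqrt (r₀ / 2 ^ (k + 1)))) := by
                rw [← ENNReal.ofReal_mul (by positivity)]; congr 1; ring
            _ ≤ ENNReal.ofReal ((a * D * Real.sqrt r₀ + b * D * Real.sqrt 2) * ε) := by
                rw [hsqrt_ratio]
                apply ENNReal.ofReal_le_ofReal
                have : a * ε * D * Real.sqrt (r₀ / 2 ^ k) ≤ a * ε * D * Real.sqrt r₀ := by gcongr
                nlinarith
      have hsplit := kltl_lintegral_split_le (A ∩ K (r₀ / 2 ^ k)) (K (r₀ / 2 ^ (k + 1))) f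
      have hinter : (A ∩ K (r₀ / 2 ^ k)) ∩ K (r₀ / 2 ^ (k + 1)) ⊆ A ∩ K (r₀ / 2 ^ (k + 1)) :=
        fun θ hθ => ⟨hθ.1.1, hθ.2⟩
      have hmono : ∫⁻ θ in (A ∩ K (r₀ / 2 ^ k)) ∩ K (r₀ / 2 ^ (k + 1)), f θ ≤
          ∫⁻ θ in A ∩ K (r₀ / 2 ^ (k + 1)), f θ := lintegral_mono' (Measure.restrict_mono hinter le_rfl) le_rfl
      calc ∫⁻ θ in A ∩ K r₀, f θ
          ≤ ENNReal.ofReal (k * ((a * D * Real.sqrt r₀ + b * D * Real.sqrt 2) * ε)) +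
              ∫⁻ θ in A ∩ K (r₀ / 2 ^ k), f θ := ih
        _ ≤ ENNReal.ofReal (k * ((a * D * Real.sqrt r₀ + b * D * Real.sqrt 2) * ε)) +
              (ENNReal.ofReal ((a * D * Real.sqrt r₀ + b * D * Real.sqrt 2) * ε) +
                ∫⁻ θ in A ∩ K (r₀ / 2 ^ (k + 1)), f θ) := by
            gcongr
            exact hsplit.trans (by rw [add_comm]; exact add_le_add hlayer hmono)
        _ = ENNReal.ofReal (((k + 1 : ℕ) : ℝ) * ((a * D * Real.sqrt r₀ + b * D * Real.sqrt 2) * ε)) +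
              ∫⁻ θ in A ∩ K (r₀ / 2 ^ (k + 1)), f θ := by
            rw [← add_assoc, ← ENNReal.ofReal_add (by positivity) (by positivity)]
            congr 2; push_cast; ring
  -- the innermost layer
  have htail : ∫⁻ θ in A ∩ K (r₀ / 2 ^ n), f θ ≤ ENNReal.ofReal (M * D * Real.sqrt (r₀ / 2 ^ n)) := by
    refine (kltl_setLIntegral_le_const_mul (c := ENNReal.ofReal M) fun θ hθ => hfM θ hθ.1).trans ?_
    calc ENNReal.ofReal M * volume (A ∩ K (r₀ / 2 ^ n))
        ≤ ENNReal.ofReal M * ENNReal.ofReal (D * Real.sqrt (r₀ / 2 ^ n)) := by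
          gcongr; exact hvol _ (by positivity)
      _ = ENNReal.ofReal (M * D * Real.sqrt (r₀ / 2 ^ n)) := by rw [← ENNReal.ofReal_mul hM]; congr 1; ring
  calc ∫⁻ θ in A, f θ ≤ (∫⁻ θ in A ∩ K r₀, f θ) + ∫⁻ θ in A \ K r₀, f θ := kltl_lintegral_split_le A (K r₀) f
    _ ≤ (ENNReal.ofReal (n * ((a * D * Real.sqrt r₀ + b * D * Real.sqrt 2) * ε)) +
          ENNReal.ofReal (M * D * Real.sqrt (r₀ / 2 ^ n))) + ENNReal.ofReal ((a * ε + b * ε / Real.sqrt r₀) * L) := by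
        exact add_le_add ((peel n le_rfl).trans (add_le_add le_rfl htail)) hout
    _ = ENNReal.ofReal ((a * ε + b * ε / Real.sqrt r₀) * L + n * ((a * D * Real.sqrt r₀ + b * D * Real.sqrt 2) * ε) +
          M * D * Real.sqrt (r₀ / 2 ^ n)) := by
        rw [← ENNReal.ofReal_add (by positivity) (by positivity), ← ENNReal.ofReal_add (by positivity) (by positivity)]
        congr 1; ring

end Summit.HubbardSuperconductivity.HubbardSuperconductivity.Theorems

end
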